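import Summits.Ventures.CertifiedManyBodySolver.Downfold.RouterWordScoreSingletonTypings

/-!
# The d⁹-host control M245 AgF₂: its two-word typing «1BH+3BE+CI | 1BH+CI» collapses to ONE word for the §4.2 score
# (seat hubbard-downfold-score-2 gen 20; companion of `RouterWordScoreSingletonTypings.lean` p750409, filed BEFORE the M245 record)

Venture CertifiedManyBodySolver, cell `pub/hubbard-downfold`; namespace `Summit.Ventures.CertifiedManyBodySolver.Downfold.RouterScore`.
Everything here is PROVED (no `sorry`, standard axioms).

The only v8 row typed on the cuprate branch words is M245 AgF₂ (D-0150 QUEUE row 50, «the designed d⁹-host router-null»: α-AgF₂,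
Ag²⁺ 4d⁹ S = ½ charge-transfer antiferromagnetic insulator; run-8 g13 WAVE 2 PREREG 2026-08-29T23:18Z, record ≈ 3 h later; score-2's
pre-word addendum block25 23:3xZ): `expected_router_words = ['1BH+3BE+CI', '1BH+CI']`. The second word «1BH+CI» has the same primary
as the first and its tokens are a subset of the first's, i.e. it DOMINATES «1BH+3BE+CI» (`Dominates`, p744404); by
`outcome_append_redundant` the dominated word is redundant, so the typing scores every print exactly like the single compound word
«1BH+CI» (`score_agf2Typing_eq_single`), which `outcome_single_alt` (p750409 §1) reads in closed form (`score_agf2`, `agf2_agree_iff`).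
Consequence named before the record: the Emery token «3BE» is SCORE-INERT on this row — the cell asks only «is the print LED by
1BH, and does CI ride?»; the block25 table follows by `decide` (`agf2_preword_table`).

WHAT THIS IS NOT: not physics, not a statement about AgF₂, not a typing ruling (the words are the curators' and the lead's R-er letter)
and not the scorer of record — the kernel form of what the §4.2 letter can and cannot tell apart on this typing.
-/

namespace Summit.Ventures.CertifiedManyBodySolver.Downfold

namespace RouterScore

open Head

/-! ## §1 The typing as filed, its collapse, the closed form -/

/-- the AgF₂ typing as filed: «1BH+3BE+CI | 1BH+CI». [folklore] -/
def agf2Typing : List (List Head) := [[bh1, be3, ci], [bh1, ci]]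

/-- «1BH+CI» dominates «1BH+3BE+CI» (same primary, fewer tokens). [folklore] -/
theorem dominates_bh1ci : Dominates [bh1, ci] [bh1, be3, ci] :=
  ⟨rfl, fun t ht => by
    simp only [List.mem_cons, List.not_mem_nil, or_false] at ht
    rcases ht with rfl | rfl <;> simp⟩

/-- THE AgF₂ TYPING ≡ THE SINGLE WORD «1BH+CI» ON EVERY PRINT (the «3BE» token is score-inert on M245). [folklore] -/
theorem score_agf2Typing_eq_single (e : List Head) : score e agf2Typing = score e [[bh1, ci]] := by
  have h1 : score e agf2Typing = score e ([[bh1, ci]] ++ [[bh1, be3, ci]]) :=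
    outcome_alts_congr Head.structural e (by
      intro a; simp only [agf2Typing, List.cons_append, List.nil_append, List.mem_cons, List.not_mem_nil, or_false]; tauto)
  rw [h1]
  exact outcome_append_redundant Head.structural e (alts := [[bh1, ci]]) (List.mem_singleton_self _) dominates_bh1ci

/-- M245 IN CLOSED FORM (§1 on the surviving word): structural-led ⇒ ABSTAIN(structure); led by «1BH» ⇒ AGREE iff «CI» is printed,
else PARTIAL; led by anything else ⇒ PARTIAL iff «1BH» rides, else DISAGREE. [folklore] -/
theorem score_agf2 (p : Head) (tl : List Head) :
    score (p :: tl) agf2Typing =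
      (if p.structural then .ABSTAIN_structure
       else if p = bh1 then (if covers (p :: tl) [ci] then .AGREE else .PARTIAL)
       else if bh1 ∈ tl then .PARTIAL else .DISAGREE) := by
  rw [score_agf2Typing_eq_single]
  exact outcome_single_alt Head.structural p bh1 tl [ci] rfl

/-- M245: `AGREE` iff the print is led by «1BH» with «CI» among its words — with or without «3BE». [folklore] -/
theorem agf2_agree_iff (p : Head) (tl : List Head) :
    score (p :: tl) agf2Typing = .AGREE ↔ p = bh1 ∧ ci ∈ p :: tl := by
  rw [score_agf2]
  by_cases hs : p.structural = true
  · rw [if_pos hs]; constructor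
    · intro h; exact absurd h (by decide)
    · rintro ⟨rfl, _⟩; exact absurd hs (by decide)
  rw [if_neg hs]
  by_cases hp : p = bh1
  · rw [if_pos hp]
    by_cases hc : covers (p :: tl) [ci] = true
    · rw [if_pos hc]; simp only [covers, List.all_cons, List.all_nil, Bool.and_true, decide_eq_true_eq] at hc
      exact ⟨fun _ => ⟨hp, hc⟩, fun _ => rfl⟩
    · rw [if_neg hc]; simp only [covers, List.all_cons, List.all_nil, Bool.and_true, decide_eq_true_eq] at hc
      exact ⟨fun h => absurd h (by decide), fun h => absurd h.2 hc⟩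
  rw [if_neg hp]
  by_cases hm : bh1 ∈ tl
  · rw [if_pos hm]; exact ⟨fun h => absurd h (by decide), fun h => absurd h.1 hp⟩
  · rw [if_neg hm]; exact ⟨fun h => absurd h (by decide), fun h => absurd h.1 hp⟩

/-- The block25 pre-word table for M245 by `decide` (value-free, registered ≈ 3 h before the record): «1BH+3BE+CI», «1BH+CI»,
«1BH+CI+3BE+UND:LATTICE rider» ⇒ AGREE; «1BH+3BE» / «1BH» without CI ⇒ PARTIAL; the U-school straddle composite (M56 shape), a
k = 2 head or «BI» or «EPH» LEADING with 1BH riding ⇒ PARTIAL; bare «EPH» (the designed D-0098 null firing), «UND:MULTIORB(k=2)»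
alone, a straddle without 1BH, «BI» / «CI» alone ⇒ DISAGREE; a structure-led print ⇒ ABSTAIN. [folklore] -/
theorem agf2_preword_table :
    score [bh1, be3, ci] agf2Typing = .AGREE ∧ score [bh1, ci] agf2Typing = .AGREE ∧
    score [bh1, ci, be3, undLattice] agf2Typing = .AGREE ∧
    score [bh1, be3] agf2Typing = .PARTIAL ∧ score [bh1] agf2Typing = .PARTIAL ∧
    score [undMixed, bh1, be3, eph, ci] agf2Typing = .PARTIAL ∧ score [undMultiorb, bh1, ci] agf2Typing = .PARTIAL ∧
    score [bi, bh1, be3, ci] agf2Typing = .PARTIAL ∧ score [eph, bh1, be3, ci] agf2Typing = .PARTIAL ∧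
    score [eph] agf2Typing = .DISAGREE ∧ score [undMultiorb] agf2Typing = .DISAGREE ∧
    score [undMixed, eph] agf2Typing = .DISAGREE ∧ score [bi] agf2Typing = .DISAGREE ∧ score [ci] agf2Typing = .DISAGREE ∧
    score [undStruct, bh1, be3, ci] agf2Typing = .ABSTAIN_structure := by
  decide

/-! ## §2 (append, g20 2026-08-30T01:2xZ) STRUCTPAIR «EPH ∣ EPH+UND:STRUCT» ≡ EPH-ONLY for the score (M327 / M444 / M503 BaTi₂Pn₂O;
the HfV₂ switch named-not-taken by R-xs)

The Ti-1221 oxypnictide rows M327 BaTi₂Sb₂O, M444 BaTi₂Bi₂O and M503 BaTi₂As₂O (lead g32 R-xw, 2026-08-30T00:56Z) carry the typing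
«EPH ∣ EPH+UND:STRUCT» (cur-1's switch name STRUCTPAIR; also offered and declined for M501 HfV₂, R-xs). The second word has the same
primary as the first and MORE tokens, so the bare «EPH» DOMINATES it: by `outcome_append_redundant` (p744404) the typing scores every
print exactly like EPH-ONLY (p750409 `ephOnly`). Registered in prose in score-2's block29 / block31 («STRUCTPAIR is score-inert
bookkeeping for the structural text»); proved here. -/

/-- STRUCTPAIR «EPH ∣ EPH+UND:STRUCT» (M327 / M444 / M503). [folklore] -/
def structpair : List (List Head) := [[eph], [eph, undStruct]]

/-- «EPH» dominates «EPH+UND:STRUCT». [folklore] -/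
theorem dominates_eph_ephStruct : Dominates [eph] [eph, undStruct] :=
  ⟨rfl, fun t ht => by simp only [List.mem_singleton] at ht; subst ht; exact List.mem_cons_self⟩

/-- STRUCTPAIR ≡ EPH-ONLY ON EVERY PRINT: the «+UND:STRUCT» word changes no verdict (a STRUCT rider behind «EPH» is AGREE under plain
«EPH» already; a STRUCT-LED print abstains under both, since «EPH+UND:STRUCT» is EPH-led and no alternative expects a structural
primary). [folklore] -/
theorem score_structpair_eq_ephOnly (e : List Head) : score e structpair = score e ephOnly :=
  outcome_append_redundant Head.structural e (alts := ephOnly) (List.mem_singleton_self _) dominates_eph_ephStruct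

/-- … hence the Ti-1221 cells in closed form: AGREE iff led by «EPH»; PARTIAL iff «EPH» rides behind a non-structural head (the Ti-3d
straddle of record on M327 / M444, pre-named for M503); DISAGREE iff no «EPH»; structure-led ⇒ ABSTAIN. [folklore] -/
theorem score_structpair (p : Head) (tl : List Head) :
    score (p :: tl) structpair =
      (if p.structural then .ABSTAIN_structure
       else if p = eph then .AGREE
       else if eph ∈ tl then .PARTIAL else .DISAGREE) := by
  rw [score_structpair_eq_ephOnly, score_ephOnly]

/-- The block31 table for M503 BaTi₂As₂O by `decide` (≡ M327 / M444): «EPH», «EPH+UND:STRUCT(nematic)», «EPH+SA» ⇒ AGREE; the Ti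
straddle «UND:MIXED+EPH(±UND:STRUCT)» ⇒ PARTIAL (the like-for-like print of record ×2); a Ti k-head with EPH ⇒ PARTIAL; rider-less
«UND:MIXED», «BI» ⇒ DISAGREE; a structure-LED print ⇒ ABSTAIN(structure). [folklore] -/
theorem bati2pn2o_table :
    score [eph] structpair = .AGREE ∧ score [eph, undStruct] structpair = .AGREE ∧ score [eph, sa] structpair = .AGREE ∧
    score [undMixed, eph] structpair = .PARTIAL ∧ score [undMixed, eph, undStruct] structpair = .PARTIAL ∧
    score [undMultiorb, eph] structpair = .PARTIAL ∧
    score [undMixed] structpair = .DISAGREE ∧ score [bi] structpair = .DISAGREE ∧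
    score [undStruct, eph] structpair = .ABSTAIN_structure := by
  decide

end RouterScore

end Summit.Ventures.CertifiedManyBodySolver.Downfold
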